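import Summits.Ventures.HSemireg.WeilFrameRealCarrierDegrees
import Summits.Ventures.HSemireg.Mod4LeadingTermPins

/-!
# Venture HSemireg — TABLE R's `ch(O_Z)`-SHAPE ROWS ON THE REAL CARRIER AT THE PINS, every `n` and every tail:
# at `t = (−1)ⁿ C(n,a)² q_n²`: `(n+3)·C(2n,n) − 2 ≤ dim S_n(x) + 2(n+1) ≤ (n+3)·C(2n,n) − 1`; `= … − 1` at the self-dual pin, `= … − 2` for odd `n`

HONEST FRAMING. Part of the Lean index of the computation cell `pub-hsemireg` (seat w3-mod4-1 gen 14, W3 SPECIAL FIBRES;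
MOD4-OFFSPLIT §8 TABLE R rows «q_n η_n + … + q_{2n} η_{2n} + w» (`ch(O_Z)` generic ∕ middle + points ∕ pure middle): middle entries
`24`, `112`, `480` with drops `22∕23` (`n = 2`), `110` (`n = 3`), `478∕479` (`n = 4`, kit j179422) exactly on the locus `(w,w)_χ = 2Dq_n²`;
§13.23 NET «ON the pin set the drop (1 or 2) depends on the tail and is NOT treated»). The tree's real carriers and the Literature's
Weil-type layer ONLY: no semiregularity map, no Ext group, no `∫`; nothing here says that HC / HC_CM / HC_AV holds; nothing here is a
claim about any explicit variety or cycle; no Literature fact is declared; NO definition is introduced. Imports: FILE 13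
`WeilFrameRealCarrierDegrees` (built) + the pure matrix file `Mod4LeadingTermPins` (over `Mod4LeadingTermMiddle`, `Mod4PureMiddleSpectrum`).

WHAT IS PROVED, for `A : AbelianVariety ℂ` of dimension `2n` (`n ≥ 1`), `φ ≫ φ = -(d • 𝟙 A)`, `d ≥ 1`, `P, Q` the
`±i√d`-eigenspaces, `dim (P ⊓ H^{1,0}) = n`, `h` `K`-symmetric of type `(1,1)` with `ĥ^{2n} ≠ 0`, non-zero `c± ∈ E±`, the class
`x = Σ_{m ≤ 2n} (q_m/m!) ĥ^m + ĉ₊ + ĉ₋` with `q_m = 0` for all `m < n`, `q_n ≠ 0` and ANY `q_{n+1}, …, q_{2n}` (the `ch(O_Z)`-shapes),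
the pin `(2n)!·(ĉ₊ĉ₋) = t·ĥ^{2n}` with `t = (−1)ⁿ C(n,a)² q_n²` for some `a ≤ n`:
* **`finrank_S_leading_middle_pin_le`** ∕ **`le_finrank_S_leading_middle_pin`** — `dim S_n(x) + 2(n+1) + 1 ≤ (n+3)·C(2n,n)` and
  `(n+3)·C(2n,n) ≤ dim S_n(x) + 2(n+1) + 2`: AT EVERY PIN THE MIDDLE ENTRY DROPS BY `1` OR `2`, never `0`, never more
  (`r_n = n + 1`; `1 ≤ dim ker(M_f − t) ≤ 2` by `Mod4LeadingTermPins`);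
* **`finrank_S_leading_middle_self_dual_pin`** — at the self-dual pin `2a = n`: `dim S_n(x) + 2(n+1) + 1 = (n+3)·C(2n,n)` (drop exactly `1`);
* **`finrank_S_leading_middle_pin_odd`** — `n` ODD: `dim S_n(x) + 2(n+1) + 2 = (n+3)·C(2n,n)` at EVERY pin for EVERY tail (drop exactly
  `2`: `M_f = (−1)ⁿT_f²` and the triangular `T_f` has both eigenvalues `±C(n,a)q_n` at the entries `a`, `n − a` of opposite parity).
READING: `n = 2`: middle entry `∈ {22, 23}` at `t = q₂²` and `= 23` at `t = 4q₂²`; `n = 3`: `= 110` at `t = −q₃²` and at `t = −9q₃²`,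
every tail (§8 rows 1–2: `110`); `n = 4`: `∈ {478, 479}` at `t = q₄², 16q₄²` and `= 479` at `t = 36q₄²` — §8's `478` (pure) ∕ `479`
(generic `O_Z`) at `q₄²` are the two values of the first bracket; for even `n` off the self-dual pin the choice `1 ∕ 2` is one polynomial
condition on the tail (`n = 2`: `2` iff `3q₂q₄ = 2q₃²`; pencil + machine, not typed). Everything PROVED, 0 sorry.
References: [BuchweitzFlenner2008HH] Prop. 6.4.4; [vanGeemen1994HodgeAV] 4.9, Lemma 5.2; [BourbakiAlgebre1a3] Ch. III §8, §11 no. 9.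
-/

noncomputable section

open CliffordAlgebra (contractLeft)
open ExteriorAlgebra (ι)
open Module CategoryTheory
open Literature.AlgebraicGeometry.Motives Literature.AlgebraicGeometry.HodgeTheory
open Literature.AlgebraicTopology.SingularHomology

namespace Summit.Ventures.HSemireg.WeilFrame

open Summit.Ventures.HSemireg.WedgeBridge Summit.Ventures.HSemireg.WeilCarrier Summit.Ventures.HSemireg.Mod4Carrier
open Summit.Ventures.HSemireg.Wedge.Hankel

section RealCarrier

variable {A : AbelianVariety ℂ}

/-- **`ch(O_Z)`-shape rows AT A PIN, upper bound on the real carrier** (`n ≥ 1`): for `q_m = 0` (`m < n`), `q_n ≠ 0`, any tail,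
`a ≤ n` and the pin `t = (−1)ⁿ C(n,a)² q_n²`: `dim S_n(x) + 2(n+1) + 1 ≤ (n+3)·C(2n,n)` — the middle entry DROPS at every pin.
[cite: BuchweitzFlenner2008HH, Prop. 6.4.4] [cite: vanGeemen1994HodgeAV, 4.9 and Lemma 5.2] -/
theorem finrank_S_leading_middle_pin_le (hA : IsSmoothProjective A.dim A.X) {n d : ℕ} (hdim : A.dim = n + n) (hd : 0 < d)
    {φ : A ⟶ A} (hφ : φ ≫ φ = -(d • 𝟙 A)) {P Q : Submodule ℂ (complexBetti A.X 1)}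
    (hP : P = Module.End.eigenspace (complexBetti.map φ.hom.hom.hom 1).hom (Complex.I * (Real.sqrt d : ℂ)))
    (hQ : Q = Module.End.eigenspace (complexBetti.map φ.hom.hom.hom 1).hom (-(Complex.I * (Real.sqrt d : ℂ))))
    (hp : finrank ℂ ↥(P ⊓ hodgeOneZero hA) = n) {h : complexBetti A.X 2}
    (hh : complexBetti.map φ.hom.hom.hom 2 h = (d : ℂ) • h) (h11 : IsOfHodgeType A.dim A.X 2 1 1 h)
    (hvol : ((⋀[ℂ]^2 (complexBetti A.X 1)).subtype ((abelianVarietyCohomologyExteriorH1_holds.equiv A 2).symm h)) ^ (n + n) ≠ 0)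
    {cP cQ : complexBetti A.X (2 * n)} (hcP : cP ∈ weilClassesPlus A φ n d) (hcP0 : cP ≠ 0)
    (hcQ : cQ ∈ weilClassesMinus A φ n d) (hcQ0 : cQ ≠ 0) (hn : 1 ≤ n)
    {q : ℕ → ℂ} (hq0 : ∀ m, m < n → q m = 0) (hqn : q n ≠ 0) {t : ℂ}
    (ht : (((n + n).factorial : ℕ) : ℂ) •
        ((⋀[ℂ]^(2 * n) (complexBetti A.X 1)).subtype ((abelianVarietyCohomologyExteriorH1_holds.equiv A (2 * n)).symm cP) *
          (⋀[ℂ]^(2 * n) (complexBetti A.X 1)).subtype ((abelianVarietyCohomologyExteriorH1_holds.equiv A (2 * n)).symm cQ)) =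
      t • ((⋀[ℂ]^2 (complexBetti A.X 1)).subtype ((abelianVarietyCohomologyExteriorH1_holds.equiv A 2).symm h)) ^ (n + n))
    {a : ℕ} (ha : a ≤ n) (hpin : t = (-1 : ℂ) ^ n * ((n.choose a : ℂ) * (n.choose a : ℂ)) * (q n * q n)) :
    finrank ℂ ↥(S ℂ (hodgeZeroOne hA) n
        ((∑ m ∈ Finset.range (n + n + 1), (q m * ((m.factorial : ℕ) : ℂ)⁻¹) •
            ((⋀[ℂ]^2 (complexBetti A.X 1)).subtype ((abelianVarietyCohomologyExteriorH1_holds.equiv A 2).symm h)) ^ m) +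
          (⋀[ℂ]^(2 * n) (complexBetti A.X 1)).subtype ((abelianVarietyCohomologyExteriorH1_holds.equiv A (2 * n)).symm cP) +
          (⋀[ℂ]^(2 * n) (complexBetti A.X 1)).subtype ((abelianVarietyCohomologyExteriorH1_holds.equiv A (2 * n)).symm cQ))) +
        2 * (n + 1) + 1 ≤ (n + 3) * (n + n).choose n := by
  haveI : Module.Finite ℂ (complexBetti A.X 1) := abelianVarietyCohomologyExteriorH1_holds.finite_one A
  have h := finrank_S_weilType_middle hA hdim hd hφ hP hQ hp hh h11 hvol hcP hcP0 hcQ hcQ0 hn q ht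
  rw [Mod4.hankel1_rank_leading_middle hq0 hqn] at h
  have h1 := Mod4.one_le_finrank_ker_middleM_leading_pin hq0 ha hpin
  have e : (n + 1 + 2) * (n + n).choose n = (n + 3) * (n + n).choose n := by ring
  omega

/-- **`ch(O_Z)`-shape rows AT A PIN, lower bound on the real carrier** (`n ≥ 1`): for `q_m = 0` (`m < n`), `q_n ≠ 0`, any tail,
`a ≤ n` and the pin `t = (−1)ⁿ C(n,a)² q_n²`: `(n+3)·C(2n,n) ≤ dim S_n(x) + 2(n+1) + 2` — the drop is at most `2`.
[cite: BuchweitzFlenner2008HH, Prop. 6.4.4] [cite: vanGeemen1994HodgeAV, 4.9 and Lemma 5.2] -/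
theorem le_finrank_S_leading_middle_pin (hA : IsSmoothProjective A.dim A.X) {n d : ℕ} (hdim : A.dim = n + n) (hd : 0 < d)
    {φ : A ⟶ A} (hφ : φ ≫ φ = -(d • 𝟙 A)) {P Q : Submodule ℂ (complexBetti A.X 1)}
    (hP : P = Module.End.eigenspace (complexBetti.map φ.hom.hom.hom 1).hom (Complex.I * (Real.sqrt d : ℂ)))
    (hQ : Q = Module.End.eigenspace (complexBetti.map φ.hom.hom.hom 1).hom (-(Complex.I * (Real.sqrt d : ℂ))))
    (hp : finrank ℂ ↥(P ⊓ hodgeOneZero hA) = n) {h : complexBetti A.X 2}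
    (hh : complexBetti.map φ.hom.hom.hom 2 h = (d : ℂ) • h) (h11 : IsOfHodgeType A.dim A.X 2 1 1 h)
    (hvol : ((⋀[ℂ]^2 (complexBetti A.X 1)).subtype ((abelianVarietyCohomologyExteriorH1_holds.equiv A 2).symm h)) ^ (n + n) ≠ 0)
    {cP cQ : complexBetti A.X (2 * n)} (hcP : cP ∈ weilClassesPlus A φ n d) (hcP0 : cP ≠ 0)
    (hcQ : cQ ∈ weilClassesMinus A φ n d) (hcQ0 : cQ ≠ 0) (hn : 1 ≤ n)
    {q : ℕ → ℂ} (hq0 : ∀ m, m < n → q m = 0) (hqn : q n ≠ 0) {t : ℂ}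
    (ht : (((n + n).factorial : ℕ) : ℂ) •
        ((⋀[ℂ]^(2 * n) (complexBetti A.X 1)).subtype ((abelianVarietyCohomologyExteriorH1_holds.equiv A (2 * n)).symm cP) *
          (⋀[ℂ]^(2 * n) (complexBetti A.X 1)).subtype ((abelianVarietyCohomologyExteriorH1_holds.equiv A (2 * n)).symm cQ)) =
      t • ((⋀[ℂ]^2 (complexBetti A.X 1)).subtype ((abelianVarietyCohomologyExteriorH1_holds.equiv A 2).symm h)) ^ (n + n))
    {a : ℕ} (ha : a ≤ n) (hpin : t = (-1 : ℂ) ^ n * ((n.choose a : ℂ) * (n.choose a : ℂ)) * (q n * q n)) :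
    (n + 3) * (n + n).choose n ≤ finrank ℂ ↥(S ℂ (hodgeZeroOne hA) n
        ((∑ m ∈ Finset.range (n + n + 1), (q m * ((m.factorial : ℕ) : ℂ)⁻¹) •
            ((⋀[ℂ]^2 (complexBetti A.X 1)).subtype ((abelianVarietyCohomologyExteriorH1_holds.equiv A 2).symm h)) ^ m) +
          (⋀[ℂ]^(2 * n) (complexBetti A.X 1)).subtype ((abelianVarietyCohomologyExteriorH1_holds.equiv A (2 * n)).symm cP) +
          (⋀[ℂ]^(2 * n) (complexBetti A.X 1)).subtype ((abelianVarietyCohomologyExteriorH1_holds.equiv A (2 * n)).symm cQ))) +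
        2 * (n + 1) + 2 := by
  haveI : Module.Finite ℂ (complexBetti A.X 1) := abelianVarietyCohomologyExteriorH1_holds.finite_one A
  have h := finrank_S_weilType_middle hA hdim hd hφ hP hQ hp hh h11 hvol hcP hcP0 hcQ hcQ0 hn q ht
  rw [Mod4.hankel1_rank_leading_middle hq0 hqn] at h
  have h2 := Mod4.finrank_ker_middleM_leading_pin_le_two hq0 hqn ha hpin
  have e : (n + 1 + 2) * (n + n).choose n = (n + 3) * (n + n).choose n := by ring
  omega

/-- **`ch(O_Z)`-shape rows AT THE SELF-DUAL PIN on the real carrier** (`n ≥ 1` even, `2a = n`, `t = (−1)ⁿ C(n,a)² q_n²`): for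
`q_m = 0` (`m < n`), `q_n ≠ 0` and any tail: `dim S_n(x) + 2(n+1) + 1 = (n+3)·C(2n,n)` — the drop is exactly `1`
(`n = 2`: `23` at `t = 4q₂²`; `n = 4`: `479` at `t = 36q₄²`). [cite: BuchweitzFlenner2008HH, Prop. 6.4.4]
[cite: vanGeemen1994HodgeAV, 4.9 and Lemma 5.2] -/
theorem finrank_S_leading_middle_self_dual_pin (hA : IsSmoothProjective A.dim A.X) {n d : ℕ} (hdim : A.dim = n + n) (hd : 0 < d)
    {φ : A ⟶ A} (hφ : φ ≫ φ = -(d • 𝟙 A)) {P Q : Submodule ℂ (complexBetti A.X 1)}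
    (hP : P = Module.End.eigenspace (complexBetti.map φ.hom.hom.hom 1).hom (Complex.I * (Real.sqrt d : ℂ)))
    (hQ : Q = Module.End.eigenspace (complexBetti.map φ.hom.hom.hom 1).hom (-(Complex.I * (Real.sqrt d : ℂ))))
    (hp : finrank ℂ ↥(P ⊓ hodgeOneZero hA) = n) {h : complexBetti A.X 2}
    (hh : complexBetti.map φ.hom.hom.hom 2 h = (d : ℂ) • h) (h11 : IsOfHodgeType A.dim A.X 2 1 1 h)
    (hvol : ((⋀[ℂ]^2 (complexBetti A.X 1)).subtype ((abelianVarietyCohomologyExteriorH1_holds.equiv A 2).symm h)) ^ (n + n) ≠ 0)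
    {cP cQ : complexBetti A.X (2 * n)} (hcP : cP ∈ weilClassesPlus A φ n d) (hcP0 : cP ≠ 0)
    (hcQ : cQ ∈ weilClassesMinus A φ n d) (hcQ0 : cQ ≠ 0) (hn : 1 ≤ n)
    {q : ℕ → ℂ} (hq0 : ∀ m, m < n → q m = 0) (hqn : q n ≠ 0) {t : ℂ}
    (ht : (((n + n).factorial : ℕ) : ℂ) •
        ((⋀[ℂ]^(2 * n) (complexBetti A.X 1)).subtype ((abelianVarietyCohomologyExteriorH1_holds.equiv A (2 * n)).symm cP) *
          (⋀[ℂ]^(2 * n) (complexBetti A.X 1)).subtype ((abelianVarietyCohomologyExteriorH1_holds.equiv A (2 * n)).symm cQ)) =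
      t • ((⋀[ℂ]^2 (complexBetti A.X 1)).subtype ((abelianVarietyCohomologyExteriorH1_holds.equiv A 2).symm h)) ^ (n + n))
    {a : ℕ} (ha : 2 * a = n) (hpin : t = (-1 : ℂ) ^ n * ((n.choose a : ℂ) * (n.choose a : ℂ)) * (q n * q n)) :
    finrank ℂ ↥(S ℂ (hodgeZeroOne hA) n
        ((∑ m ∈ Finset.range (n + n + 1), (q m * ((m.factorial : ℕ) : ℂ)⁻¹) •
            ((⋀[ℂ]^2 (complexBetti A.X 1)).subtype ((abelianVarietyCohomologyExteriorH1_holds.equiv A 2).symm h)) ^ m) +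
          (⋀[ℂ]^(2 * n) (complexBetti A.X 1)).subtype ((abelianVarietyCohomologyExteriorH1_holds.equiv A (2 * n)).symm cP) +
          (⋀[ℂ]^(2 * n) (complexBetti A.X 1)).subtype ((abelianVarietyCohomologyExteriorH1_holds.equiv A (2 * n)).symm cQ))) +
        2 * (n + 1) + 1 = (n + 3) * (n + n).choose n := by
  haveI : Module.Finite ℂ (complexBetti A.X 1) := abelianVarietyCohomologyExteriorH1_holds.finite_one A
  have h := finrank_S_weilType_middle hA hdim hd hφ hP hQ hp hh h11 hvol hcP hcP0 hcQ hcQ0 hn q ht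
  rw [Mod4.hankel1_rank_leading_middle hq0 hqn, Mod4.finrank_ker_middleM_leading_pin_self_dual hq0 hqn ha hpin] at h
  have e : (n + 1 + 2) * (n + n).choose n = (n + 3) * (n + n).choose n := by ring
  omega

/-- **`ch(O_Z)`-shape rows AT A PIN, ODD `n`, on the real carrier** (`n ≥ 1` odd, `a ≤ n`, `t = (−1)ⁿ C(n,a)² q_n²`): for
`q_m = 0` (`m < n`), `q_n ≠ 0` and ANY tail: `dim S_n(x) + 2(n+1) + 2 = (n+3)·C(2n,n)` — the drop is exactly `2` at every pin
(`n = 3`: `110` at `t = −q₃²` and at `t = −9q₃²`, whatever `q₄, q₅, q₆`). [cite: BuchweitzFlenner2008HH, Prop. 6.4.4]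
[cite: vanGeemen1994HodgeAV, 4.9 and Lemma 5.2] -/
theorem finrank_S_leading_middle_pin_odd (hA : IsSmoothProjective A.dim A.X) {n d : ℕ} (hdim : A.dim = n + n) (hd : 0 < d)
    {φ : A ⟶ A} (hφ : φ ≫ φ = -(d • 𝟙 A)) {P Q : Submodule ℂ (complexBetti A.X 1)}
    (hP : P = Module.End.eigenspace (complexBetti.map φ.hom.hom.hom 1).hom (Complex.I * (Real.sqrt d : ℂ)))
    (hQ : Q = Module.End.eigenspace (complexBetti.map φ.hom.hom.hom 1).hom (-(Complex.I * (Real.sqrt d : ℂ))))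
    (hp : finrank ℂ ↥(P ⊓ hodgeOneZero hA) = n) {h : complexBetti A.X 2}
    (hh : complexBetti.map φ.hom.hom.hom 2 h = (d : ℂ) • h) (h11 : IsOfHodgeType A.dim A.X 2 1 1 h)
    (hvol : ((⋀[ℂ]^2 (complexBetti A.X 1)).subtype ((abelianVarietyCohomologyExteriorH1_holds.equiv A 2).symm h)) ^ (n + n) ≠ 0)
    {cP cQ : complexBetti A.X (2 * n)} (hcP : cP ∈ weilClassesPlus A φ n d) (hcP0 : cP ≠ 0)
    (hcQ : cQ ∈ weilClassesMinus A φ n d) (hcQ0 : cQ ≠ 0) (hn : 1 ≤ n)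
    {q : ℕ → ℂ} (hq0 : ∀ m, m < n → q m = 0) (hqn : q n ≠ 0) {t : ℂ}
    (ht : (((n + n).factorial : ℕ) : ℂ) •
        ((⋀[ℂ]^(2 * n) (complexBetti A.X 1)).subtype ((abelianVarietyCohomologyExteriorH1_holds.equiv A (2 * n)).symm cP) *
          (⋀[ℂ]^(2 * n) (complexBetti A.X 1)).subtype ((abelianVarietyCohomologyExteriorH1_holds.equiv A (2 * n)).symm cQ)) =
      t • ((⋀[ℂ]^2 (complexBetti A.X 1)).subtype ((abelianVarietyCohomologyExteriorH1_holds.equiv A 2).symm h)) ^ (n + n))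
    (hodd : Odd n) {a : ℕ} (ha : a ≤ n) (hpin : t = (-1 : ℂ) ^ n * ((n.choose a : ℂ) * (n.choose a : ℂ)) * (q n * q n)) :
    finrank ℂ ↥(S ℂ (hodgeZeroOne hA) n
        ((∑ m ∈ Finset.range (n + n + 1), (q m * ((m.factorial : ℕ) : ℂ)⁻¹) •
            ((⋀[ℂ]^2 (complexBetti A.X 1)).subtype ((abelianVarietyCohomologyExteriorH1_holds.equiv A 2).symm h)) ^ m) +
          (⋀[ℂ]^(2 * n) (complexBetti A.X 1)).subtype ((abelianVarietyCohomologyExteriorH1_holds.equiv A (2 * n)).symm cP) +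
          (⋀[ℂ]^(2 * n) (complexBetti A.X 1)).subtype ((abelianVarietyCohomologyExteriorH1_holds.equiv A (2 * n)).symm cQ))) +
        2 * (n + 1) + 2 = (n + 3) * (n + n).choose n := by
  haveI : Module.Finite ℂ (complexBetti A.X 1) := abelianVarietyCohomologyExteriorH1_holds.finite_one A
  have h := finrank_S_weilType_middle hA hdim hd hφ hP hQ hp hh h11 hvol hcP hcP0 hcQ hcQ0 hn q ht
  rw [Mod4.hankel1_rank_leading_middle hq0 hqn, Mod4.finrank_ker_middleM_leading_pin_odd hodd hq0 hqn ha hpin] at h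
  have e : (n + 1 + 2) * (n + n).choose n = (n + 3) * (n + n).choose n := by ring
  omega

end RealCarrier

end Summit.Ventures.HSemireg.WeilFrame

end
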